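import Summits.NavierStokesRegularity.FluidComputer.BlockReadout
import Summits.NavierStokesRegularity.NavierStokesRegularity.Theorems.PerpetualPumpEulerTypeIGlueDuhamel

/-!
# Fluid computer, block design — the readout of a TRUE Navier–Stokes trajectory at `t = 0⁺`

HONEST FRAMING: low prior, high value-of-information experiment on Tao's machine paradigm; NOT a
claim that NS blows up. This file contains NO circuit design and NO blow-up statement: it is a
small piece of UNCONDITIONAL analysis of the true (`ν = 1`) Navier–Stokes equation in Tao's mild
`H¹⁰_df` formulation (`IsMildSolutionFor eulerForm`, [cite: Tao2016AveragedNS, §1.1 (1.15)]),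
read through the block readout `read n` of `BlockReadout.lean`. Its purpose is the NO-GO theorem
of `BlockReachViscous.lean` (the lane's re-typed residue
`OpenReachBound … (quadVF k η) (loadedRegion η) ε` of `BlockQuadReach.lean` is FALSE as typed, for
every `ε`, because of viscosity).

WHAT IS PROVED (all [folklore]: first-year semigroup calculus, written out for Tao's mild form).
(§1) (a mild solution attains its `H¹⁰_df` datum exactly, `u 0 = a`: the landed `initial_eq` of
`Literature/…/FluidComputer/CascadeWitness.lean`, reused, not restated.)
`hasDerivWithinAt_duhamel_zero`: for an `H¹⁰`-continuous, `H¹⁰`-bounded curve `v` on `[0, T₁]`,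
the Duhamel term `t ↦ ∫₀ᵗ ⟨B(v s, v s), e^{(t-s)Δ} w⟩ ds` has right derivative `⟨B(v 0, v 0), w⟩`
at `t = 0` (three-term trilinear estimate, `norm_eulerForm_le`).
(§2) `viscRate 𝒟 n = ∫ 4π²|ξ|² |ψ̂_n(ξ)|² dξ = ‖∇ψ_n‖²₂`, the viscous rate of the design mode
`ψ_n`, with `4π² ≤ viscRate 𝒟 n` (`ψ̂_n` lives on `|ξ| > 2ⁿ ≥ 1`); `pairing_heat_mode_eq`,
`hasDerivWithinAt_pairing_heat_mode`: `⟨e^{tΔ}ψ_n, ψ_n⟩ = ∫ e^{-4π²|ξ|²t}|ψ̂_n|²` has right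
derivative `-viscRate 𝒟 n` at `t = 0`.
(§3) `eulerForm_smul_mode_self`: `⟨B(cψ_n, cψ_n), ψ_n⟩ = 0` (energy identity `⟨B(a,a),a⟩ = 0`,
[cite: Tao2016AveragedNS, (1.6)]); `hasDerivWithinAt_read_fst_clean`: along EVERY mild
Navier–Stokes solution issued from the clean design state `recon n (A, 0) = A√E_n ψ_n`, the input
readout `a(t) = Re⟨u(t), ψ_n⟩/√E_n` has right derivative `-(viscRate 𝒟 n) · A` at `t = 0`:
pure viscous decay, the nonlinearity contributing exactly zero at that instant.

HONEST READING. Nothing here is specific to blow-up; the content is that the block readout of the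
true equation SEES the viscous diagonal `-Λ_n a` at every clean loaded state, with `Λ_n ≥ 4π²`
independent of the amplitude `A` — whereas every energy-conserving design field of this lane
(`quadVF`, `QuadField`, `ω(a,b)·(-ηb, a)`) has first component `0` on the input ray `b = 0`.
-/

noncomputable section

open MeasureTheory Set Filter Topology Metric
open scoped ENNReal NNReal

namespace Summit.NavierStokesRegularity.FluidComputer

open Literature.Analysis.FluidPDE Literature.Analysis.FluidPDE.Tao2016
open Literature.Analysis.FluidPDE.FluidComputer
open Literature.Analysis.FunctionSpaces (eFourierSobolevNorm)
open Summit.NavierStokesRegularity.NavierStokesRegularity.Theorems.PerpetualPumpEulerTypeIGlue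

namespace BlockDesign

/-! ### §1. Mild solutions at `t = 0⁺`: the Duhamel term (the datum: `initial_eq`, in tree) -/

section Mild

/-- **The Duhamel term of the mild formulation has right derivative `⟨B(v 0, v 0), w⟩` at
`t = 0`.** For an `H¹⁰`-continuous curve `v` on `[0, T₁]` with `‖v s‖_{H¹⁰} ≤ M`, the map
`t ↦ ∫₀ᵗ ⟨B(v s, v s), e^{(t-s)Δ} w⟩ ds` is right-differentiable at `0` with derivative
`⟨B(v 0, v 0), w⟩`: the integrand is within `o(1)` of that constant on `[0, t]` as `t → 0⁺`
(trilinear bound `norm_eulerForm_le`, `H¹⁰`-continuity of `v` at `0`, strong continuity of the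
heat semigroup at `0`). [folklore] -/
theorem hasDerivWithinAt_duhamel_zero {T₁ : ℝ} (hT : 0 < T₁) {v : ℝ → L2C}
    (hv : ContinuousInH10On (Icc 0 T₁) v) {M : ℝ}
    (hM : ∀ s ∈ Icc 0 T₁, eFourierSobolevNorm 10 (v s) ≤ ENNReal.ofReal M) (w : L2C) :
    HasDerivWithinAt (fun t => ∫ s in (0:ℝ)..t, eulerForm (v s) (v s) (heat (t - s) w))
      (eulerForm (v 0) (v 0) w) (Ici 0) 0 := by
  have hfin : ∀ s ∈ Icc 0 T₁, eFourierSobolevNorm 10 (v s) < ⊤ :=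
    fun s hs => lt_of_le_of_lt (hM s hs) ENNReal.ofReal_lt_top
  set K : ℝ := Real.pi * (2 * ((∫⁻ ξ : EuclideanSpace ℝ (Fin 3),
    ENNReal.ofReal ((1 + ‖ξ‖ ^ 2) ^ (-10 : ℝ))) ^ (1 / 2 : ℝ)).toReal) with hK
  have hK0 : 0 ≤ K := by positivity
  set M' : ℝ := max M 0 with hM'
  have hM'0 : 0 ≤ M' := le_max_right _ _
  have hreal : ∀ s ∈ Icc 0 T₁, (eFourierSobolevNorm 10 (v s)).toReal ≤ M' := by
    intro s hs
    have h := ENNReal.toReal_mono ENNReal.ofReal_ne_top (hM s hs)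
    by_cases hM0 : 0 ≤ M
    · rw [ENNReal.toReal_ofReal hM0] at h; exact h.trans (le_max_left _ _)
    · rw [ENNReal.ofReal_of_nonpos (not_le.1 hM0).le, ENNReal.toReal_zero] at h
      exact h.trans hM'0
  have h0mem : (0 : ℝ) ∈ Icc 0 T₁ := ⟨le_rfl, hT.le⟩
  -- the three-term bound on the integrand minus its value at `s = 0`, `τ = 0`
  have hbound : ∀ s ∈ Icc 0 T₁, ∀ τ : ℝ,
      ‖eulerForm (v s) (v s) (heat τ w) - eulerForm (v 0) (v 0) w‖ ≤
        (K * M' * ‖w‖) * (eFourierSobolevNorm 10 (v s - v 0)).toReal +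
        (K * M' * ‖w‖) * (eFourierSobolevNorm 10 (v s - v 0)).toReal +
        (K * M' * M') * ‖heat τ w - w‖ := by
    intro s hs τ
    have e1 := eulerForm_sub₁ (heat τ w) (hfin s hs) (hfin 0 h0mem) (hfin s hs)
    have e2 := eulerForm_sub₂ (heat τ w) (hfin 0 h0mem) (hfin s hs) (hfin 0 h0mem)
    have e3 := eulerForm_sub₃ (heat τ w) w (hfin 0 h0mem) (hfin 0 h0mem)
    have hdec : eulerForm (v s) (v s) (heat τ w) - eulerForm (v 0) (v 0) w =
        eulerForm (v s - v 0) (v s) (heat τ w) + eulerForm (v 0) (v s - v 0) (heat τ w) +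
          eulerForm (v 0) (v 0) (heat τ w - w) := by
      rw [← e1, ← e2, ← e3]; ring
    rw [hdec]
    have hsub := eFourierSobolevNorm_sub_lt_top (hfin s hs) (hfin 0 h0mem)
    set E : ℝ := (eFourierSobolevNorm 10 (v s - v 0)).toReal with hE
    have hE0 : 0 ≤ E := ENNReal.toReal_nonneg
    have hw0 := norm_nonneg w
    have hhw := norm_heat_le τ w
    have t1 : ‖eulerForm (v s - v 0) (v s) (heat τ w)‖ ≤ (K * M' * ‖w‖) * E := by
      refine (norm_eulerForm_le _ hsub (hfin s hs)).trans ?_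
      have h1 := hreal s hs
      calc K * E * (eFourierSobolevNorm 10 (v s)).toReal * ‖heat τ w‖
          ≤ K * E * M' * ‖w‖ := by gcongr
        _ = (K * M' * ‖w‖) * E := by ring
    have t2 : ‖eulerForm (v 0) (v s - v 0) (heat τ w)‖ ≤ (K * M' * ‖w‖) * E := by
      refine (norm_eulerForm_le _ (hfin 0 h0mem) hsub).trans ?_
      have h1 := hreal 0 h0mem
      calc K * (eFourierSobolevNorm 10 (v 0)).toReal * E * ‖heat τ w‖
          ≤ K * M' * E * ‖w‖ := by gcongr
        _ = (K * M' * ‖w‖) * E := by ring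
    have t3 : ‖eulerForm (v 0) (v 0) (heat τ w - w)‖ ≤ (K * M' * M') * ‖heat τ w - w‖ := by
      refine (norm_eulerForm_le _ (hfin 0 h0mem) (hfin 0 h0mem)).trans ?_
      have h1 := hreal 0 h0mem
      gcongr
    exact (norm_add₃_le).trans (add_le_add_three t1 t2 t3)
  -- `o(t)`-form of the right derivative
  rw [hasDerivWithinAt_iff_isLittleO, Asymptotics.isLittleO_iff]
  intro c hc
  set Q : ℝ := K * M' * ‖w‖ + K * M' * ‖w‖ + K * M' * M' + 1 with hQ
  have hQ0 : 0 < Q := by positivity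
  set η : ℝ := c / Q with hη
  have hη0 : 0 < η := div_pos hc hQ0
  have hH10 : Tendsto (fun s => (eFourierSobolevNorm 10 (v s - v 0)).toReal)
      (𝓝[Icc 0 T₁] 0) (𝓝 0) := by
    have h := (ENNReal.tendsto_toReal ENNReal.zero_ne_top).comp (hv 0 h0mem)
    rwa [ENNReal.toReal_zero] at h
  obtain ⟨δ₁, hδ₁, h₁⟩ := Metric.tendsto_nhdsWithin_nhds.1 hH10 η hη0
  have hheat : Tendsto (fun τ => heat τ w) (𝓝 0) (𝓝 w) := by
    have h := (continuous_heat_apply w).tendsto 0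
    rwa [heat_zero] at h
  obtain ⟨δ₂, hδ₂, h₂⟩ := Metric.tendsto_nhds_nhds.1 hheat η hη0
  have hδ : (0 : ℝ) < min (min δ₁ δ₂) T₁ := lt_min (lt_min hδ₁ hδ₂) hT
  filter_upwards [Ico_mem_nhdsGE hδ] with t ht
  obtain ⟨ht0, htδ⟩ := ht
  have htδ₁ : t < δ₁ := lt_of_lt_of_le htδ ((min_le_left _ _).trans (min_le_left _ _))
  have htδ₂ : t < δ₂ := lt_of_lt_of_le htδ ((min_le_left _ _).trans (min_le_right _ _))
  have htT : t ≤ T₁ := (lt_of_lt_of_le htδ (min_le_right _ _)).le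
  have hIcc : Icc 0 t ⊆ Icc 0 T₁ := Icc_subset_Icc le_rfl htT
  -- pointwise smallness of the integrand minus the claimed derivative on `(0, t]`
  have hpt : ∀ s ∈ uIoc (0:ℝ) t,
      ‖eulerForm (v s) (v s) (heat (t - s) w) - eulerForm (v 0) (v 0) w‖ ≤ c := by
    intro s hs
    rw [uIoc_of_le ht0] at hs
    have hsI : s ∈ Icc 0 T₁ := hIcc ⟨hs.1.le, hs.2⟩
    have hvs : (eFourierSobolevNorm 10 (v s - v 0)).toReal ≤ η := by
      have h := h₁ hsI (by rw [dist_zero_right, Real.norm_of_nonneg hs.1.le]; linarith [hs.2])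
      rw [dist_zero_right, Real.norm_of_nonneg ENNReal.toReal_nonneg] at h
      exact h.le
    have hws : ‖heat (t - s) w - w‖ ≤ η := by
      have hts0 : 0 ≤ t - s := by linarith [hs.2]
      have hts : dist (t - s) 0 < δ₂ := by
        rw [dist_zero_right, Real.norm_of_nonneg hts0]; linarith [hs.1]
      have h := h₂ hts
      rw [dist_eq_norm] at h
      exact h.le
    have hKw : 0 ≤ K * M' * ‖w‖ := by positivity
    have hKM : 0 ≤ K * M' * M' := by positivity
    calc ‖eulerForm (v s) (v s) (heat (t - s) w) - eulerForm (v 0) (v 0) w‖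
        ≤ (K * M' * ‖w‖) * (eFourierSobolevNorm 10 (v s - v 0)).toReal +
          (K * M' * ‖w‖) * (eFourierSobolevNorm 10 (v s - v 0)).toReal +
          (K * M' * M') * ‖heat (t - s) w - w‖ := hbound s hsI (t - s)
      _ ≤ (K * M' * ‖w‖) * η + (K * M' * ‖w‖) * η + (K * M' * M') * η := by gcongr
      _ ≤ Q * η := by rw [hQ]; nlinarith
      _ = c := by rw [hη]; field_simp
  have hcont : ContinuousInH10On (Icc 0 t) v := hv.mono hIcc
  have hint : IntervalIntegrable (fun s => eulerForm (v s) (v s) (heat (t - s) w)) volume 0 t :=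
    intervalIntegrable_eulerForm_heat hv hM w (by rw [uIcc_of_le ht0]; exact hIcc)
  have hsplit : (∫ s in (0:ℝ)..t, eulerForm (v s) (v s) (heat (t - s) w)) -
      (t - 0) • eulerForm (v 0) (v 0) w =
      ∫ s in (0:ℝ)..t, (eulerForm (v s) (v s) (heat (t - s) w) - eulerForm (v 0) (v 0) w) := by
    rw [intervalIntegral.integral_sub hint intervalIntegrable_const,
      intervalIntegral.integral_const]
  rw [intervalIntegral.integral_same, sub_zero, hsplit]
  refine (intervalIntegral.norm_integral_le_of_norm_le_const hpt).trans ?_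
  rw [sub_zero, Real.norm_of_nonneg ht0, abs_of_nonneg ht0]

end Mild

/-! ### §2. The viscous rate of a design mode -/

section Visc

variable (𝒟 : CascadeWaveletData 1 1)

/-- The VISCOUS RATE of the design mode `ψ_n`:
`Λ_n = ∫ 4π²|ξ|² |ψ̂_n(ξ)|² dξ = ‖∇ψ_n‖²₂ = -⟨Δψ_n, ψ_n⟩` (`∼ 4π² 4ⁿ`). [folklore] -/
def viscRate (n : ℕ) : ℝ := ∫ ξ, heatRate ξ * modeWeight 𝒟 0 (n : ℤ) ξ

/-- `Λ_n ≥ 4π²`: `ψ̂_n` is supported in `|ξ| > 2ⁿ ≥ 1` and `∫ |ψ̂_n|² = 1`.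
[cite: Tao2016AveragedNS, §4 p. 21] -/
theorem four_pi_sq_le_viscRate (n : ℕ) : 4 * Real.pi ^ 2 ≤ viscRate 𝒟 n := by
  have hle : ∀ᵐ ξ ∂(volume : Measure (EuclideanSpace ℝ (Fin 3))),
      4 * Real.pi ^ 2 * modeWeight 𝒟 0 (n : ℤ) ξ ≤ heatRate ξ * modeWeight 𝒟 0 (n : ℤ) ξ := by
    filter_upwards [𝒟.fourierFn_cascadeWavelet_eq_zero two_pos' 0 (n : ℤ)] with ξ hξ
    by_cases hmem : ξ ∈ freqRegion 𝒟 0 (n : ℤ)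
    · have h1 : (1 : ℝ) ≤ ‖ξ‖ :=
        (one_le_pow₀ (by norm_num : (1 : ℝ) ≤ 2)).trans (norm_of_mem_region 𝒟 n hmem).1.le
      have h2 : 4 * Real.pi ^ 2 ≤ heatRate ξ := by
        unfold heatRate
        have : (1 : ℝ) ≤ ‖ξ‖ ^ 2 := by nlinarith
        nlinarith [sq_nonneg Real.pi]
      exact mul_le_mul_of_nonneg_right h2 (modeWeight_nonneg ξ)
    · have h0 : modeWeight 𝒟 0 (n : ℤ) ξ = 0 := by simp [modeWeight, hξ hmem]
      simp [h0]
  calc 4 * Real.pi ^ 2 = ∫ ξ, 4 * Real.pi ^ 2 * modeWeight 𝒟 0 (n : ℤ) ξ := by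
        rw [integral_const_mul, integral_modeWeight two_pos', mul_one]
    _ ≤ viscRate 𝒟 n := integral_mono_ae ((integrable_modeWeight).const_mul _)
        (integrable_heatRate_mul_modeWeight two_pos') hle

/-- `0 < Λ_n`. [folklore] -/
theorem viscRate_pos (n : ℕ) : 0 < viscRate 𝒟 n :=
  lt_of_lt_of_le (by positivity) (four_pi_sq_le_viscRate 𝒟 n)

/-- `⟨e^{tΔ}ψ_n, ψ_n⟩ = ∫ e^{-4π²|ξ|² t} |ψ̂_n(ξ)|² dξ` for `t ≥ 0` (Plancherel; `ψ_n` real),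
written with the Duhamel scalar `duhamelScalar 1 0 L t = e^{-Lt}` of `TaoCascadeDuhamel`.
[folklore] -/
theorem pairing_heat_mode_eq (n : ℕ) {t : ℝ} (ht : 0 ≤ t) :
    pairing (heat t (mode 𝒟 n)) (mode 𝒟 n) =
      ((∫ ξ, duhamelScalar 1 (fun _ => 0) (heatRate ξ) t ^ 1 * modeWeight 𝒟 0 (n : ℤ) ξ : ℝ) :
        ℂ) := by
  rw [mode, pairing_heat_eq_integral, ← integral_complex_ofReal]
  refine integral_congr_ae ?_
  filter_upwards [fourierFn_neg_eq_conj3 (isReal_cascadeWavelet 1 (𝒟.ψ 0) (n : ℤ))] with ξ hξ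
  rw [hξ, cdot_conj3_self, heatSymbol_eq_exp_heatRate ht, modeWeight, duhamelScalar]
  simp only [zero_mul, intervalIntegral.integral_zero, add_zero, mul_one, pow_one]
  push_cast
  ring

/-- **`d/dt|_{t=0⁺} ⟨e^{tΔ}ψ_n, ψ_n⟩ = -Λ_n`** (differentiation under the integral sign,
`hasDerivAt_integral_duhamelScalar_pow` with zero forcing profile). [folklore] -/
theorem hasDerivWithinAt_pairing_heat_mode (n : ℕ) :
    HasDerivWithinAt (fun t => pairing (heat t (mode 𝒟 n)) (mode 𝒟 n))
      (((-viscRate 𝒟 n : ℝ)) : ℂ) (Ici 0) 0 := by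
  have hQ : Continuous (fun _ : ℝ => (0 : ℝ)) := continuous_const
  have h := (hasDerivAt_integral_duhamelScalar_pow (δ := 1) hQ
    (integrable_modeWeight (𝒟 := 𝒟) (i := 0) (n := (n : ℤ))) (modeWeight_eq_zero two_pos') 1 0).2
  have hval : (∫ ξ, ((1 : ℕ) : ℝ) * duhamelScalar 1 (fun _ => 0) (heatRate ξ) 0 ^ (1 - 1) *
      (-(heatRate ξ) * duhamelScalar 1 (fun _ => 0) (heatRate ξ) 0 + (fun _ : ℝ => (0:ℝ)) 0) *
        modeWeight 𝒟 0 (n : ℤ) ξ) = -viscRate 𝒟 n := by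
    rw [viscRate, ← integral_neg]
    refine integral_congr_ae (Filter.Eventually.of_forall fun ξ => ?_)
    simp only [duhamelScalar_zero, Nat.cast_one, Nat.sub_self, pow_zero, one_mul, mul_one, add_zero]
    ring
  rw [hval] at h
  exact h.ofReal_comp.hasDerivWithinAt.congr (fun t ht => pairing_heat_mode_eq 𝒟 n ht)
    (pairing_heat_mode_eq 𝒟 n le_rfl)

end Visc

/-! ### §3. The input readout of a true trajectory through a clean design state -/

section Clean

variable (𝒟 : CascadeWaveletData 1 1) (S : CascadeSpecs)

/-- The clean input state of amplitude `A`: `recon n (A, 0) = A√E_n ψ_n`. [folklore] -/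
theorem recon_fst (n : ℕ) (A : ℝ) :
    recon 𝒟 S n (A, 0) = ((A * Real.sqrt (S.Emin n) : ℝ) : ℂ) • mode 𝒟 n := by
  simp [recon]

/-- Design states lie in `H¹⁰_df`. [folklore] -/
theorem memH10df_recon (n : ℕ) (p : ℝ × ℝ) : MemH10df (recon 𝒟 S n p) :=
  ((𝒟.memH10df_cascadeWavelet two_pos' 0 (n : ℤ)).smul _).add
    ((𝒟.memH10df_cascadeWavelet two_pos' 0 ((n + 1 : ℕ) : ℤ)).smul _)

/-- `⟨B(cψ_n, cψ_n), ψ_n⟩ = 0`: the energy identity `⟨B(a,a), a⟩ = 0`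
(`eulerForm_self_eq_zero_of_memH10df`) at `a = cψ_n`, by trilinearity.
[cite: Tao2016AveragedNS, (1.6)] -/
theorem eulerForm_smul_mode_self (n : ℕ) (c : ℝ) :
    eulerForm (((c : ℝ) : ℂ) • mode 𝒟 n) (((c : ℝ) : ℂ) • mode 𝒟 n) (mode 𝒟 n) = 0 := by
  have hψ : MemH10df (mode 𝒟 n) := 𝒟.memH10df_cascadeWavelet two_pos' 0 (n : ℤ)
  have ha : MemH10df (((c : ℝ) : ℂ) • mode 𝒟 n) := hψ.smul c
  by_cases hc : c = 0
  · simp [hc, eulerForm_zero_left]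
  have h0 : eulerForm (((c : ℝ) : ℂ) • mode 𝒟 n) (((c : ℝ) : ℂ) • mode 𝒟 n) 0 = 0 := by
    have h := eulerForm_add_smul₃ (x := ((c : ℝ) : ℂ) • mode 𝒟 n) (y := ((c : ℝ) : ℂ) • mode 𝒟 n)
      (-1) (mode 𝒟 n) (mode 𝒟 n) ha.1 ha.1
    rw [neg_one_smul, add_neg_cancel] at h
    rw [h]; ring
  have hself := eulerForm_self_eq_zero_of_memH10df ha
  have h := eulerForm_add_smul₃ (x := ((c : ℝ) : ℂ) • mode 𝒟 n) (y := ((c : ℝ) : ℂ) • mode 𝒟 n)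
    ((c : ℝ) : ℂ) (0 : L2C) (mode 𝒟 n) ha.1 ha.1
  rw [zero_add, h0, zero_add, hself] at h
  exact (mul_eq_zero.1 h.symm).resolve_left (Complex.ofReal_ne_zero.2 hc)

/-- **The input readout of a true Navier–Stokes trajectory through a clean design state decays at
the viscous rate.** For EVERY `H¹⁰_df`-mild solution `u` of the true Navier–Stokes equation on
`[0, S')` issued from `recon n (A, 0) = A√E_n ψ_n`, the input readout
`a(t) = Re⟨u t, ψ_n⟩/√E_n` has right derivative `-Λ_n · A` at `t = 0` (`Λ_n = viscRate 𝒟 n ≥ 4π²`):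
the heat part contributes `-Λ_n A` (§2) and the Duhamel part contributes
`⟨B(a,a), ψ_n⟩/√E_n = 0` (`eulerForm_smul_mode_self`). [folklore] -/
theorem hasDerivWithinAt_read_fst_clean (n : ℕ) (A : ℝ) {S' : ℝ} (hS' : 0 < S') {u : ℝ → L2C}
    (hu : IsMildSolutionFor eulerForm (recon 𝒟 S n (A, 0)) (Ico 0 S') u) :
    HasDerivWithinAt (fun t => (read 𝒟 S n (u t)).1) (-(viscRate 𝒟 n * A)) (Ici 0) 0 := by
  set ψ := mode 𝒟 n with hψdef
  set c : ℝ := A * Real.sqrt (S.Emin n) with hc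
  have ha_eq : recon 𝒟 S n (A, 0) = ((c : ℝ) : ℂ) • ψ := recon_fst 𝒟 S n A
  have hψ10 : MemH10df ψ := 𝒟.memH10df_cascadeWavelet two_pos' 0 (n : ℤ)
  have ha : MemH10df (recon 𝒟 S n (A, 0)) := memH10df_recon 𝒟 S n _
  -- a compact sub-interval `[0, S'/2]` carrying a uniform `H¹⁰` bound
  have hT₁ : 0 < S' / 2 := by positivity
  have hsub : Icc 0 (S' / 2) ⊆ Ico 0 S' := fun t ht => ⟨ht.1, lt_of_le_of_lt ht.2 (by linarith)⟩
  have hv : ContinuousInH10On (Icc 0 (S' / 2)) u := hu.2.1.mono hsub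
  have hfin : ∀ s ∈ Icc 0 (S' / 2), eFourierSobolevNorm 10 (u s) < ⊤ :=
    fun s hs => (hu.1 s (hsub hs)).1
  obtain ⟨M, hM⟩ := hv.exists_bound hfin
  have hMenn : ∀ s ∈ Icc 0 (S' / 2), eFourierSobolevNorm 10 (u s) ≤ ENNReal.ofReal M := by
    intro s hs
    rw [← ENNReal.ofReal_toReal (hfin s hs).ne]
    exact ENNReal.ofReal_le_ofReal (hM s hs)
  -- Duhamel part: derivative `⟨B(u 0, u 0), ψ⟩ = ⟨B(cψ, cψ), ψ⟩ = 0`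
  have hu0 : u 0 = recon 𝒟 S n (A, 0) := initial_eq hu ⟨le_rfl, hS'⟩ ha
  have hD := hasDerivWithinAt_duhamel_zero hT₁ hv hMenn ψ
  rw [hu0, ha_eq, eulerForm_smul_mode_self] at hD
  -- heat part
  have hH := hasDerivWithinAt_pairing_heat_mode 𝒟 n
  have hg : HasDerivWithinAt (fun t => ((c : ℝ) : ℂ) * pairing (heat t ψ) ψ +
      ∫ s in (0:ℝ)..t, eulerForm (u s) (u s) (heat (t - s) ψ))
      (((c : ℝ) : ℂ) * (((-viscRate 𝒟 n : ℝ)) : ℂ) + 0) (Ici 0) 0 := (hH.const_mul _).add hD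
  -- the mild identity identifies the coefficient with the model function on `[0, S')`
  have hcoef : ∀ t ∈ Ico 0 S', coef 𝒟 n (u t) = ((c : ℝ) : ℂ) * pairing (heat t ψ) ψ +
      ∫ s in (0:ℝ)..t, eulerForm (u s) (u s) (heat (t - s) ψ) := by
    intro t ht
    unfold coef
    rw [hu.2.2 t ht ψ hψ10, ha_eq, pairing_heat_left, pairing_smul_left, ← pairing_heat_left]
  have hdc : HasDerivWithinAt (fun t => coef 𝒟 n (u t))
      (((c : ℝ) : ℂ) * (((-viscRate 𝒟 n : ℝ)) : ℂ) + 0) (Ici 0) 0 :=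
    ((hg.mono Ico_subset_Ici_self).congr (fun t ht => hcoef t ht) (hcoef 0 ⟨le_rfl, hS'⟩))
      |>.mono_of_mem_nhdsWithin (Ico_mem_nhdsGE hS')
  have key : HasDerivWithinAt (fun t => (coef 𝒟 n (u t)).re / Real.sqrt (S.Emin n))
      (((((c : ℝ) : ℂ) * (((-viscRate 𝒟 n : ℝ)) : ℂ) + 0).re) / Real.sqrt (S.Emin n)) (Ici 0) 0 :=
    (Complex.reCLM.hasFDerivAt.comp_hasDerivWithinAt 0 hdc).div_const _
  have hval : ((((c : ℝ) : ℂ) * (((-viscRate 𝒟 n : ℝ)) : ℂ) + 0).re) / Real.sqrt (S.Emin n) =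
      -(viscRate 𝒟 n * A) := by
    have hE := (sqrt_Emin_pos S n).ne'
    rw [add_zero, ← Complex.ofReal_mul, Complex.ofReal_re, hc]
    field_simp
  rw [hval] at key
  exact key

end Clean

end BlockDesign

end Summit.NavierStokesRegularity.FluidComputer
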